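import Literature.AlgebraicGeometry.PlaneCurves.HessePencilHessian
import HarnessLib

/-!
# Which members of the Hesse pencil have a given Hessian (Artebani–Dolgachev, Prop. 3.2)

Topic `Literature/AlgebraicGeometry/PlaneCurves`, namespace `Literature.AlgebraicGeometry.PlaneCurves`.
Lane `lit-hodgefound`, seat `lit-hodgefound-p37`, row g18-#1; a one-file sequel of
`HessePencilHessian` (g17-#8: `det_hessianMatrix_hesse` — `He(H_μ) = −54μ²(X³ + Y³ + Z³) +
(216 − 54μ³)XYZ` —, `hesse_basePoint` — `∇H_μ(p₀) = (3μ, 3, 3)` at `p₀ = (0, 1, −1)` —, and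
`hesse_eval_harmonicPolar` — `H_μ(x, y, y) = x³ + 2y³ − 3μxy²` on the harmonic polar `L₀ : Y = Z`).
Everything here is PROVED; no definition, no named fact.

Source followed — M. Artebani, I. Dolgachev, *The Hesse pencil of plane cubic curves*,
L'Enseignement Math. (2) 55 (2009) 235–273 [arXiv:math/0611590, held `paper:arxiv-math_0611590`
p0006 L18–L31], §3, VERBATIM:

> **Proposition 3.2.** Let `E_λ` be a nonsingular member of the Hesse pencil. Let
> `L_i ∩ E_λ = {q₁, q₂, q₃}` and `E_{λ_j}`, `j = 1, 2, 3`, be the curve from the Hesse pencil whose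
> tangent at `p_i` contains `q_j`. Then `He(E_μ) = E_λ` if and only if `μ ∈ {λ₁, λ₂, λ₃}`.
> *Proof.* It is a straightforward computation. Because of the symmetry of the Hesse
> configuration, it is enough to consider the case when `i = 0`, i.e. `p_i = (0, 1, −1)`. We have
> that `L₀ : y − z = 0` and `L₀ ∩ E_λ` is equal to the set of points `q_j = (1, y_j, y_j)`
> satisfying `1 + 2y_j³ + λy_j² = 0`. The line `p₀q_j` has the equation `−2y_j x + y + z = 0`. The
> curve `E_μ` from the Hesse pencil is tangent to this line at the point `(0, 1, −1)` if and only
> if `(−μ, 3, 3) = (−2y_j, 1, 1)`, i.e. `y_j = μ/6`. Thus `λ = −(1 + 2y_j³)/y_j² = −(108 + μ³)/(3μ²)`.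
> Comparing with the formula (hes), we see that `𝔥(μ) = λ`. This proves the assertion.

## Dictionary

* As in the predecessor files the member `E_λ = x³ + y³ + z³ + λxyz` is written, at `λ = −3μ`, as
  `H_μ = X³ + Y³ + Z³ − 3μXYZ` (local notation `𝐇[μ]`, no definition); §3 also records the
  statement in the source's own parametrisation `E_λ` (where `∇E_μ(p₀) = (−μ, 3, 3)` and
  `y_j = μ/6` literally).
* "`He(E_μ) = E_λ`" (equality of plane CURVES) is `∃ c ≠ 0, det(∂²H_ν) = c · H_μ` in
  `K[X, Y, Z]`; "the tangent to `E_ν` at `p₀` contains `q`" is `⟨∇H_ν(p₀), q⟩ = 0`; the points of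
  `L₀ ∩ E_λ` are the non-zero `(x, y, y)` with `H_μ(x, y, y) = 0`, all of which have `x ≠ 0`
  (`hesse_harmonicPolar₀_point`), so that they are the `(1, y_j, y_j)` of the source.

## What is here

* §1 `hesse_harmonicPolar₀_point` (`2 ≠ 0`: a non-zero point `(x, y, y)` of `H_μ` has `x ≠ 0`);
  `line_through_p₀` (the line `−2yX + Y + Z = 0` contains `p₀ = (0, 1, −1)` and `q = (1, y, y)`,
  and every line through both is a multiple of it); `hesse_tangent_p₀_contains_iff` — **"`E_μ` is
  tangent to this line at `(0, 1, −1)` iff `y_j = μ/6`"**: `⟨∇H_ν(p₀), (1, y, y)⟩ = 3ν + 6y`, so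
  (`2, 3 ≠ 0`) the tangent of `H_ν` at `p₀` contains `(1, y, y)` iff `y = −ν/2`.
* §2 **Proposition 3.2** (`2 ≠ 0`, `3 ≠ 0`; no smoothness hypothesis is needed):
  `hesse_hessian_eq_smul_iff` — `He(H_ν) = c·H_μ` for some `c ≠ 0` iff `3μν² = 4 − ν³` (then
  `c = −54ν²`, `ν ≠ 0`); `hesse_hessian_eq_smul_iff_eval` — iff the point `(1, −ν/2, −ν/2)` of `L₀`
  lies on `H_μ`; and **`hesse_hessian_eq_smul_iff_exists_tangent`** — THE PRINTED STATEMENT: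
  `He(H_ν) = H_μ` (as curves) iff there is a point `q = (1, y, y) ∈ L₀ ∩ H_μ` such that the tangent
  of `H_ν` at `p₀` contains `q`.  "Comparing with the formula (hes)": `hesse_hessianParameter_eq_iff`
  — for `ν ≠ 0`, `(4 − ν³)/(3ν²) = μ` iff `3μν² = 4 − ν³`.
* §3 The same in the source's parametrisation: `hesse'_grad_p₀` (`∇E_μ(p₀) = (−μ, 3, 3)`),
  `hesse'_tangent_p₀_contains_iff` (`y = μ/6`), `hesse'_eval_harmonicPolar`
  (`E_λ(1, y, y) = 1 + 2y³ + λy²`), and **`hesse'_hessian_eq_smul_iff_exists_tangent`**: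
  `He(E_μ) = c·E_λ`, `c ≠ 0`, iff some `q = (1, y, y) ∈ L₀ ∩ E_λ` lies on the tangent of `E_μ` at
  `p₀` — with `hesse'_hessian_eq_smul_iff`: iff `108 + μ³ + 3λμ² = 0`, i.e. `λ = 𝔥(μ)`.

Hypotheses, compared with the source: Artebani–Dolgachev take `E_λ` nonsingular over an
algebraically closed field of characteristic `≠ 2, 3`; the equivalence holds over every field
with `2 ≠ 0`, `3 ≠ 0`, for every `λ` (for a triangle `μ³ = 1` both sides can hold: the Hessian of a
triangle is the triangle).  Only `i = 0` is treated, as in the printed proof ("because of the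
symmetry of the Hesse configuration"); NOT here: the count "three points `q_j`" (separability of
`1 + 2y³ + λy²`), the `2`-torsion interpretation, the Cayleyan.

## References
* [ArtebaniDolgachev2009] M. Artebani, I. Dolgachev, *The Hesse pencil of plane cubic curves*,
  Enseign. Math. (2) 55 (2009) 235–273, §3, Prop. 3.2 and formula (hes).
-/

set_option autoImplicit false

open MvPolynomial Matrix
open Literature.AlgebraicGeometry.HodgeTheory (hessianMatrix)

namespace Literature.AlgebraicGeometry.PlaneCurves

universe u

/-- The Hesse cubic `H_μ = X³ + Y³ + Z³ − 3μXYZ` (local notation as in the statements of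
`HessePencilWeierstrassForm`, no definition). -/
local notation3 "𝐇[" μ "]" =>
  (X 0 ^ 3 + X 1 ^ 3 + X 2 ^ 3 - C (3 * μ) * (X 0 * X 1 * X 2) : MvPolynomial (Fin 3) _)

/-- The source's parametrisation `E_λ = x³ + y³ + z³ + λxyz` (local notation, no definition). -/
local notation3 "𝐄[" la "]" =>
  (X 0 ^ 3 + X 1 ^ 3 + X 2 ^ 3 + C la * (X 0 * X 1 * X 2) : MvPolynomial (Fin 3) _)

section HessianPreimages

variable {K : Type u} [Field K]

/-! ## §1 `L₀ ∩ E_λ`, the lines `p₀ q_j`, and the tangents at `p₀` -/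

/-- The points of `L₀ ∩ E_λ` are the `(1, y_j, y_j)`: over a field with `2 ≠ 0`, a non-zero point
`(x, y, y)` of the harmonic polar `L₀ : Y = Z` lying on `H_μ` has `x ≠ 0` (if `x = 0` then
`2y³ = 0`). [cite: ArtebaniDolgachev2009, §3, proof of Prop. 3.2 (`q_j = (1, y_j, y_j)`)] -/
theorem hesse_harmonicPolar₀_point (h2 : (2 : K) ≠ 0) (μ : K) {x y : K}
    (hq : eval ![x, y, y] 𝐇[μ] = 0) (hq0 : (![x, y, y] : Fin 3 → K) ≠ 0) : x ≠ 0 := by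
  intro hx
  rw [hesse_eval_harmonicPolar, hx] at hq
  have hy : y = 0 := by
    have : (2 : K) * y ^ 3 = 0 := by linear_combination hq
    exact (pow_eq_zero_iff three_ne_zero).1 ((mul_eq_zero.1 this).resolve_left h2)
  apply hq0
  funext i; fin_cases i <;> simp [hx, hy]

/-- **"The line `p₀q_j` has the equation `−2y_j x + y + z = 0`"**: the line `−2yX + Y + Z = 0`
contains `p₀ = (0, 1, −1)` and `q = (1, y, y)`, and every linear form vanishing at both points is
a multiple of `(−2y, 1, 1)`. [cite: ArtebaniDolgachev2009, §3, proof of Prop. 3.2] -/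
theorem line_through_p₀ (y : K) :
    (![-2 * y, 1, 1] : Fin 3 → K) ⬝ᵥ ![0, 1, -1] = 0 ∧ ![-2 * y, 1, 1] ⬝ᵥ ![1, y, y] = 0 ∧
      ∀ l : Fin 3 → K, l ⬝ᵥ ![0, 1, -1] = 0 → l ⬝ᵥ ![1, y, y] = 0 → l = l 1 • ![-2 * y, 1, 1] := by
  refine ⟨by simp [dotProduct, Fin.sum_univ_three], by simp [dotProduct, Fin.sum_univ_three]; ring,
    fun l h0 h1 => ?_⟩
  simp [dotProduct, Fin.sum_univ_three] at h0 h1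
  funext i
  fin_cases i
  · simp; linear_combination h1 + y * h0
  · simp
  · simp; linear_combination -h0

/-- **"The curve `E_μ` from the Hesse pencil is tangent to this line at the point `(0, 1, −1)` if
and only if … `y_j = μ/6`"** (here `λ = −3μ`, so `y_j = −ν/2`): `⟨∇H_ν(p₀), (1, y, y)⟩ = 3ν + 6y`
(`∇H_ν(p₀) = (3ν, 3, 3)`), hence over a field with `2, 3 ≠ 0` the tangent of `H_ν` at `p₀`
contains `q = (1, y, y)` iff `y = −ν/2`. [cite: ArtebaniDolgachev2009, §3, proof of Prop. 3.2] -/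
theorem hesse_tangent_p₀_contains_iff (ν y : K) :
    (fun i => eval ![0, 1, -1] (pderiv i 𝐇[ν])) ⬝ᵥ ![1, y, y] = 3 * ν + 6 * y ∧
      ((2 : K) ≠ 0 → (3 : K) ≠ 0 →
        ((fun i => eval ![0, 1, -1] (pderiv i 𝐇[ν])) ⬝ᵥ ![1, y, y] = 0 ↔ y = -ν / 2)) := by
  have e : (fun i => eval ![0, 1, -1] (pderiv i 𝐇[ν])) ⬝ᵥ ![1, y, y] = 3 * ν + 6 * y := by
    rw [(hesse_basePoint ν).2]
    simp [dotProduct, Fin.sum_univ_three]; ring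
  refine ⟨e, fun h2 h3 => ?_⟩
  rw [e]
  constructor
  · intro h
    rw [eq_div_iff h2]
    apply (mul_right_inj' h3).1
    linear_combination h
  · rintro rfl
    field_simp
    ring

/-! ## §2 Proposition 3.2 -/

/-- **`He(H_ν) = c · H_μ` with `c ≠ 0` iff `3μν² = 4 − ν³`** (over a field with `2 ≠ 0`, `3 ≠ 0`;
then `c = −54ν²` and `ν ≠ 0`): evaluate `He(H_ν) = −54ν²(X³ + Y³ + Z³) + (216 − 54ν³)XYZ` and
`c · H_μ` at `(1, 0, 0)` and `(1, 1, 1)`. [cite: ArtebaniDolgachev2009, §3, Prop. 3.2 and formula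
(hes)] -/
theorem hesse_hessian_eq_smul_iff (h2 : (2 : K) ≠ 0) (h3 : (3 : K) ≠ 0) (μ ν : K) :
    (∃ c : K, c ≠ 0 ∧ (hessianMatrix 𝐇[ν]).det = c • 𝐇[μ]) ↔ 3 * μ * ν ^ 2 = 4 - ν ^ 3 := by
  have h54 : (54 : K) ≠ 0 := by
    rw [show (54 : K) = 2 * 3 ^ 3 by norm_num]
    exact mul_ne_zero h2 (pow_ne_zero 3 h3)
  constructor
  · rintro ⟨c, hc, h⟩
    rw [det_hessianMatrix_hesse] at h
    have h100 := congrArg (eval ![(1 : K), 0, 0]) h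
    have h111 := congrArg (eval ![(1 : K), 1, 1]) h
    simp [smul_eval] at h100 h111
    -- `h100 : −54ν² = c`, `h111 : −162ν² + 216 − 54ν³ = c(3 − 3μ)`
    have key : (54 : K) * (3 * μ * ν ^ 2 - (4 - ν ^ 3)) = 0 := by
      linear_combination (3 - 3 * μ) * h100 - h111
    linear_combination (mul_eq_zero.1 key).resolve_left h54
  · intro h
    have hν : ν ≠ 0 := by
      rintro rfl
      have : (4 : K) = 0 := by linear_combination -h
      exact (show (4 : K) ≠ 0 by rw [show (4 : K) = 2 * 2 by norm_num]; exact mul_ne_zero h2 h2) this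
    refine ⟨-(54 * ν ^ 2), neg_ne_zero.2 (mul_ne_zero h54 (pow_ne_zero 2 hν)), ?_⟩
    rw [det_hessianMatrix_hesse, smul_eq_C_mul]
    have e : (C (216 - 54 * ν ^ 3) : MvPolynomial (Fin 3) K) =
        C (-(54 * ν ^ 2)) * -C (3 * μ) := by
      rw [← C_neg, ← C_mul]; congr 1; linear_combination (-54 : K) * h
    rw [e]
    ring

/-- **Prop. 3.2 through the point `q_j`**: `He(H_ν) = c · H_μ` for some `c ≠ 0` iff the point
`(1, −ν/2, −ν/2)` of the harmonic polar `L₀` lies on `H_μ` (`2, 3 ≠ 0`; `H_μ(1, y, y) =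
1 + 2y³ − 3μy²`). [cite: ArtebaniDolgachev2009, §3, Prop. 3.2 (proof: "`λ = −(1 + 2y_j³)/y_j²`")] -/
theorem hesse_hessian_eq_smul_iff_eval (h2 : (2 : K) ≠ 0) (h3 : (3 : K) ≠ 0) (μ ν : K) :
    (∃ c : K, c ≠ 0 ∧ (hessianMatrix 𝐇[ν]).det = c • 𝐇[μ]) ↔
      eval ![1, -ν / 2, -ν / 2] 𝐇[μ] = 0 := by
  have h4 : (4 : K) ≠ 0 := by
    rw [show (4 : K) = 2 ^ 2 by norm_num]; exact pow_ne_zero 2 h2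
  have e : eval ![1, -ν / 2, -ν / 2] 𝐇[μ] = (4 - ν ^ 3 - 3 * μ * ν ^ 2) / 4 := by
    rw [hesse_eval_harmonicPolar]
    field_simp
    ring
  rw [hesse_hessian_eq_smul_iff h2 h3, e, div_eq_zero_iff, or_iff_left h4]
  constructor <;> intro h <;> linear_combination -h

/-- **Proposition 3.2 (Artebani–Dolgachev), as printed, for `i = 0`**: over a field with `2 ≠ 0`
and `3 ≠ 0`, `He(H_ν) = H_μ` as plane curves (`det(∂²H_ν) = c · H_μ`, `c ≠ 0`) if and only if there
is a point `q = (1, y, y)` of `L₀ ∩ H_μ` such that the tangent of `H_ν` at `p₀ = (0, 1, −1)`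
contains `q` — i.e. iff `ν` is one of the parameters `λ_j` of the statement.
[cite: ArtebaniDolgachev2009, §3, Prop. 3.2] -/
theorem hesse_hessian_eq_smul_iff_exists_tangent (h2 : (2 : K) ≠ 0) (h3 : (3 : K) ≠ 0) (μ ν : K) :
    (∃ c : K, c ≠ 0 ∧ (hessianMatrix 𝐇[ν]).det = c • 𝐇[μ]) ↔
      ∃ y : K, eval ![1, y, y] 𝐇[μ] = 0 ∧
        (fun i => eval ![0, 1, -1] (pderiv i 𝐇[ν])) ⬝ᵥ ![1, y, y] = 0 := by
  rw [hesse_hessian_eq_smul_iff_eval h2 h3]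
  constructor
  · intro h
    exact ⟨-ν / 2, h, ((hesse_tangent_p₀_contains_iff ν (-ν / 2)).2 h2 h3).2 rfl⟩
  · rintro ⟨y, hy, ht⟩
    obtain rfl := ((hesse_tangent_p₀_contains_iff ν y).2 h2 h3).1 ht
    exact hy

/-- **"Comparing with the formula (hes), we see that `𝔥(μ) = λ`"**: for `ν ≠ 0` the Hessian
parameter `𝔥 : ν ↦ (4 − ν³)/(3ν²)` of `HessePencilHessian.det_hessianMatrix_hesse_eq_smul` takes the
value `μ` iff `3μν² = 4 − ν³` (`3 ≠ 0`). [cite: ArtebaniDolgachev2009, §3, Prop. 3.2 and formula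
(hes)] -/
theorem hesse_hessianParameter_eq_iff (h3 : (3 : K) ≠ 0) (μ : K) {ν : K} (hν : ν ≠ 0) :
    (4 - ν ^ 3) / (3 * ν ^ 2) = μ ↔ 3 * μ * ν ^ 2 = 4 - ν ^ 3 := by
  rw [div_eq_iff (mul_ne_zero h3 (pow_ne_zero 2 hν))]
  constructor <;> intro h <;> linear_combination -h

/-! ## §3 The same in the source's parametrisation `E_λ = x³ + y³ + z³ + λxyz` -/

/-- `∇E_μ(p₀) = (−μ, 3, 3)` at `p₀ = (0, 1, −1)`, and `E_μ(p₀) = 0` ("`(−μ, 3, 3)`" in the printed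
proof). [cite: ArtebaniDolgachev2009, §3, proof of Prop. 3.2] -/
theorem hesse'_grad_p₀ (mu : K) :
    eval ![0, 1, -1] 𝐄[mu] = 0 ∧ (fun i => eval ![0, 1, -1] (pderiv i 𝐄[mu])) = ![-mu, 3, 3] := by
  constructor
  · simp; norm_num
  · funext i
    fin_cases i <;> simp [pderiv_X]

/-- **"`E_μ` … is tangent to this line at the point `(0, 1, −1)` if and only if
`(−μ, 3, 3) = (−2y_j, 1, 1)`, i.e. `y_j = μ/6`"**: `⟨∇E_μ(p₀), (1, y, y)⟩ = −μ + 6y`, so (with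
`2, 3 ≠ 0`) the tangent of `E_μ` at `p₀` contains `(1, y, y)` iff `y = μ/6`.
[cite: ArtebaniDolgachev2009, §3, proof of Prop. 3.2] -/
theorem hesse'_tangent_p₀_contains_iff (mu y : K) :
    (fun i => eval ![0, 1, -1] (pderiv i 𝐄[mu])) ⬝ᵥ ![1, y, y] = -mu + 6 * y ∧
      ((2 : K) ≠ 0 → (3 : K) ≠ 0 →
        ((fun i => eval ![0, 1, -1] (pderiv i 𝐄[mu])) ⬝ᵥ ![1, y, y] = 0 ↔ y = mu / 6)) := by
  have e : (fun i => eval ![0, 1, -1] (pderiv i 𝐄[mu])) ⬝ᵥ ![1, y, y] = -mu + 6 * y := by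
    rw [(hesse'_grad_p₀ mu).2]
    simp [dotProduct, Fin.sum_univ_three]; ring
  refine ⟨e, fun h2 h3 => ?_⟩
  rw [e]
  have h6 : (6 : K) ≠ 0 := by
    rw [show (6 : K) = 2 * 3 by norm_num]; exact mul_ne_zero h2 h3
  rw [eq_div_iff h6]
  constructor <;> intro h <;> linear_combination h

/-- **"`L₀ ∩ E_λ` is equal to the set of points `q_j = (1, y_j, y_j)` satisfying
`1 + 2y_j³ + λy_j² = 0`"**: `E_λ(1, y, y) = 1 + 2y³ + λy²`. [cite: ArtebaniDolgachev2009, §3, proof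
of Prop. 3.2] -/
theorem hesse'_eval_harmonicPolar (la y : K) : eval ![1, y, y] 𝐄[la] = 1 + 2 * y ^ 3 + la * y ^ 2 := by
  simp; ring

/-- **`He(E_μ) = c · E_λ` with `c ≠ 0` iff `108 + μ³ + 3λμ² = 0`** (i.e. `λ = −(108 + μ³)/(3μ²) =
𝔥(μ)`; `2, 3 ≠ 0`; then `c = −6μ²`): from `He(E_μ) = −6μ²(x³ + y³ + z³) + (216 + 2μ³)xyz`
(`HessePencilHessian.det_hessianMatrix_hesse'`) evaluated at `(1, 0, 0)` and `(1, 1, 1)`.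
[cite: ArtebaniDolgachev2009, §3, Prop. 3.2 and formula (hes)] -/
theorem hesse'_hessian_eq_smul_iff (h2 : (2 : K) ≠ 0) (h3 : (3 : K) ≠ 0) (la mu : K) :
    (∃ c : K, c ≠ 0 ∧ (hessianMatrix 𝐄[mu]).det = c • 𝐄[la]) ↔
      108 + mu ^ 3 + 3 * la * mu ^ 2 = 0 := by
  have h6 : (6 : K) ≠ 0 := by
    rw [show (6 : K) = 2 * 3 by norm_num]; exact mul_ne_zero h2 h3
  constructor
  · rintro ⟨c, hc, h⟩
    rw [det_hessianMatrix_hesse'] at h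
    have h100 := congrArg (eval ![(1 : K), 0, 0]) h
    have h111 := congrArg (eval ![(1 : K), 1, 1]) h
    simp [smul_eval] at h100 h111
    -- `h100 : −6μ² = c`, `h111 : −18μ² + 216 + 2μ³ = c(3 + λ)`
    have key : (2 : K) * (108 + mu ^ 3 + 3 * la * mu ^ 2) = 0 := by
      linear_combination h111 - (3 + la) * h100
    exact (mul_eq_zero.1 key).resolve_left h2
  · intro h
    have hmu : mu ≠ 0 := by
      rintro rfl
      have h108 : (108 : K) ≠ 0 := by
        rw [show (108 : K) = 2 ^ 2 * 3 ^ 3 by norm_num]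
        exact mul_ne_zero (pow_ne_zero 2 h2) (pow_ne_zero 3 h3)
      exact h108 (by linear_combination h)
    refine ⟨-(6 * mu ^ 2), neg_ne_zero.2 (mul_ne_zero h6 (pow_ne_zero 2 hmu)), ?_⟩
    rw [det_hessianMatrix_hesse', smul_eq_C_mul]
    have e : (C (216 + 2 * mu ^ 3) : MvPolynomial (Fin 3) K) = C (-(6 * mu ^ 2)) * C la := by
      rw [← C_mul]; congr 1; linear_combination (2 : K) * h
    rw [e]
    ring

/-- **Proposition 3.2 in the source's parametrisation, `i = 0`**: over a field with `2, 3 ≠ 0`,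
`He(E_μ) = E_λ` as curves iff there is a point `q = (1, y, y) ∈ L₀ ∩ E_λ`
(`1 + 2y³ + λy² = 0`) on the tangent of `E_μ` at `p₀` (`y = μ/6`) — "Thus
`λ = −(1 + 2y_j³)/y_j² = −(108 + μ³)/(3μ²)`". [cite: ArtebaniDolgachev2009, §3, Prop. 3.2] -/
theorem hesse'_hessian_eq_smul_iff_exists_tangent (h2 : (2 : K) ≠ 0) (h3 : (3 : K) ≠ 0)
    (la mu : K) :
    (∃ c : K, c ≠ 0 ∧ (hessianMatrix 𝐄[mu]).det = c • 𝐄[la]) ↔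
      ∃ y : K, eval ![1, y, y] 𝐄[la] = 0 ∧
        (fun i => eval ![0, 1, -1] (pderiv i 𝐄[mu])) ⬝ᵥ ![1, y, y] = 0 := by
  rw [hesse'_hessian_eq_smul_iff h2 h3]
  have h6 : (6 : K) ≠ 0 := by
    rw [show (6 : K) = 2 * 3 by norm_num]; exact mul_ne_zero h2 h3
  have h108 : (108 : K) ≠ 0 := by
    rw [show (108 : K) = 2 ^ 2 * 3 ^ 3 by norm_num]
    exact mul_ne_zero (pow_ne_zero 2 h2) (pow_ne_zero 3 h3)
  have e : eval ![1, mu / 6, mu / 6] 𝐄[la] = (108 + mu ^ 3 + 3 * la * mu ^ 2) / 108 := by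
    rw [hesse'_eval_harmonicPolar]
    field_simp
    ring
  constructor
  · intro h
    refine ⟨mu / 6, ?_, ((hesse'_tangent_p₀_contains_iff mu (mu / 6)).2 h2 h3).2 rfl⟩
    rw [e, h, zero_div]
  · rintro ⟨y, hy, ht⟩
    obtain rfl := ((hesse'_tangent_p₀_contains_iff mu y).2 h2 h3).1 ht
    rw [e, div_eq_zero_iff] at hy
    exact hy.resolve_right h108

end HessianPreimages

end Literature.AlgebraicGeometry.PlaneCurves
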